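import Summits.QuantumFields.QCD.Theses.FourMirrorsWardE1
import Summits.QuantumFields.QCD.Theses.TransparentRPWall

/-!
# `QCD → HonestLatticeLimit` — the sub-problem statement implies the crux (S → C)

Crux-strategist r1 evidence for `stmt-QuantumFields-18092` (`FourMirrorsWardE1.HonestLatticeLimit`, shared verbatim
with `TransparentRPWall.HonestLatticeLimit`): the crux is a CONSEQUENCE of the sub-problem statement `QCD`.
Given `QCD`, take for the labelled Schwinger family the Schwinger functions `T.schwinger` of the OS datum `T`
that `QCDOf N_f` provides: E0 / E0′ / E3 / translation invariance are fields of `OSData`; the hypercubic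
(signed-permutation) invariance clause is the special case of full proper Euclidean invariance
`T.invariant.2` (it only adds a hypothesis on `R`); `IsQCDAlong` is literally the triple (asymptotic scaling,
physical branch, convergence of `qcdLatticeSchwinger` to `T.schwinger`); `OSData.IsNontrivial` /
`OSData.IsNonGaussian` unfold to the crux's `NT` / `NG` clauses; the lattice mass gap is a conjunct of `QCDOf`.

Consequence for the tribunal (T1 / BC2, rule (b) "the summit gives it back"): `HonestLatticeLimit` is implied by
`QCD` and is used toward `QCD` in `closes`; the converse `HonestLatticeLimit → QCD` needs the OPEN items
`GappedLimitClosure` (E0-herm, E2, E4, continuum gap) and `RotationRestoration` (rotation half of E1), so the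
crux is not equivalent to the summit by any landed theorem — but the axioms it drops (Hermiticity, RP,
clustering, full rotations, continuum gap) unlock no named tool for what it keeps (the UV-stable continuum
limit of lattice QCD with dynamical Wilson quarks at a volume-uniform lattice mass gap), which is why the
strategist files the REDIRECT onto `LadderCauchyRate` + `CalibratedTightness` + `DiscreteRemnant`
(landed assembly `HonestLatticeLimitSplit.honestLatticeLimit_of_ladderCauchyRate_of_tightness_of_remnant`).
-/

namespace Summit.QuantumFields.QCD.Theorems.HonestLatticeLimitOfQCD

open Literature.MathematicalPhysics.QuantumLattice Literature.MathematicalPhysics.AQFT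
  Literature.MathematicalPhysics.QuantumFieldTheory

/-- **S → C.** The sub-problem statement `QCD` implies the crux `FourMirrorsWardE1.HonestLatticeLimit`
(witness: the Schwinger functions of the OS datum). [folklore] -/
theorem honestLatticeLimit_of_qcd (h : QCD) :
    Summit.QuantumFields.QCD.Theses.FourMirrorsWardE1.HonestLatticeLimit := by
  have hOf : ∀ Nf : ℕ, (Nf = 2 ∨ Nf = 3) → QCDOf Nf := by
    rintro Nf (rfl | rfl)
    exacts [h.1, h.2]
  intro Nf hNf
  obtain ⟨reg, hScal, hChi, hAll⟩ := hOf Nf hNf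
  refine ⟨reg, hScal, hChi, fun m hm => ?_⟩
  obtain ⟨z, shift, T, ⟨hAS, hBranch, hConv⟩, hNT, hNG, hND, Δ, hΔ, -, hGapL⟩ := hAll m hm
  refine ⟨z, shift, T.schwinger, ⟨⟨T.normalized, T.linearGrowth, T.symmetric, T.invariant.1,
    fun n k R hdet _ F hF => T.invariant.2 n k R hdet F hF⟩, ⟨hAS, hBranch, hConv⟩, Δ, hΔ, hGapL⟩,
    hNT, hNG, hND⟩

/-- The same for the verbatim-identical shared copy `TransparentRPWall.HonestLatticeLimit`. [folklore] -/
theorem honestLatticeLimit_of_qcd' (h : QCD) :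
    Summit.QuantumFields.QCD.Theses.TransparentRPWall.HonestLatticeLimit :=
  honestLatticeLimit_of_qcd h

end Summit.QuantumFields.QCD.Theorems.HonestLatticeLimitOfQCD
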